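import Literature.MathematicalPhysics.QuantumFieldTheory.Balaban1983to89.B3Sect3Subtraction319

/-!
# `Balaban1983to89.B3Sect3WickCancellation` — T. Bałaban, *(Higgs)₂,₃ quantum fields in a finite volume. III. Renormalization*,
Commun. Math. Phys. **88** (1983) 411–445 [Balaban1983Higgs3], Sect. 3 p. 435: the WICK-ORDERING CANCELLATION of the tadpole graphs
(3.6)₂, (3.6)₃ against their mass-renormalization counterterms (3.7)₂, (3.7)₃

statement-level skeleton of published theorems with citation tags; proofs where landed; nothing here is a claim about the Yang–Mills mass gap

PDF held: `paper:balaban1983-higgs-2-3-quantum-fields-finite-volume` (journal page = PDF page + 410); render read as an image: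
`…/b2b-balaban-ref1/pages/1983-cmp88-higgs23-III/1983-cmp88-higgs23-III-p025-x2.png` (p. 435).
CITATION HEADER (lean-in-tree rule).  lit-balaban TYPED SKELETON (HOME `run/shared/lean/pub/lit-balaban/`), Phase 2, seat p18 (gen 3),
unit `lit-balaban-p18`; SKELETON row **B3.Eq3.6-3.9** (cell so far: «(3.6)–(3.8) pictures and the Wick-ordering cancellation sentence
not typed»; the pictures (3.6) are the model graphs `…B3Sect3LowestOrderGraphs.g36a/g36b/g36c`, p248264), fold owner r15.  CARRIER OF
RECORD, reused and not re-declared: r15's `…B3Sect3Subtraction319.subtracted319 η Σ φ φ′` =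
Σ_{x,x′} η^{2d} φ(x)·Σ(x,x′)φ′(x′) − Σ_x η^d φ(x)·(Σ_{x′} η^d Σ(x,x′))φ′(x) — the expression of a two-scalar-leg graph with kernel
Σ(x,x′) PLUS the expression of its mass-renormalization counterterm graph «(−1)·(the same graph with both external legs localized
in x)» (p. 417: *"δm²_G = Σ_{x′∈T_ε} ε^d Σ^ε_G(x − x′) will be represented by the same graph G but with both external legs localized
in x and with the summation over x′"*; p. 438: *"a graph with mass renormalization counterterm of the form −Σ_{x′}η^dΣ(x,x′)"*).

THE PRINTED TEXT (p. 435 [PDF 25], verbatim).  *"Let us start with self-energy graphs for scalar fields. The graphs of lowest order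
are [three pictures] (D = −d + 2), (3.6) and the renormalized class G_ren contains the corresponding mass renormalization
counterterms also: (−1)·[picture], (−1)·[picture], (−1)·[picture] (3.7) The two last terms in (3.7) cancel exactly the two last
terms in (3.6), so the expressions containing these terms vanish (Wick ordering)."*  The two last pictures of (3.6) are the
A′-tadpole at the vertex (1.10)_{2,0} and the φ′-tadpole at the vertex (1.6): ONE vertex, both external φ′-legs at that vertex, so
the kernel Σ(x,x′) of either graph is LOCAL — supported on the diagonal x = x′ (on the lattice: Σ(x,x′) = η^{−d}·1_{x=x′}·T with a
fixed map T of the internal indices, e.g. a multiple of q² for the A′-tadpole).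

WHAT THIS MODULE PROVES (sorry-free, theorems only, every torus `Site P j`, every real inner-product space `W` of internal
indices).  `subtracted319_eq_zero_of_local`: for EVERY kernel Σ vanishing off the diagonal, graph + counterterm = `subtracted319 η Σ
φ φ′` = 0 identically in the legs φ, φ′ — the printed cancellation, which is exact and needs no property of the propagators beyond
locality of the tadpole kernel; `graphTerm_eq_counterTerm_of_local`: the same as the equality of the two expressions;
`tadpole_cancellation`: the instance Σ(x,x′) = η^{−d}·1_{x=x′}·T.  By contrast the FIRST picture of (3.6) has the non-local kernel
of (3.9) (r15 `…B3Sect3ScalarSelfEnergy.expr39`) and survives as (3.8).  NOT here: the values of the tadpole constants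
(C^ε(0), C^ε_0(0) of (1.22)), the graph model, anything about convergence.
-/

namespace Literature.MathematicalPhysics.QuantumFieldTheory.Balaban1983to89.B3Sect3WickCancellation

open B3Sect3Subtraction319

open scoped RealInnerProductSpace

variable {P : Params} {j : ℕ} {W : Type*} [NormedAddCommGroup W] [InnerProductSpace ℝ W]

/-- **p. 435** [PDF 25], verbatim: *"The two last terms in (3.7) cancel exactly the two last terms in (3.6), so the expressions
containing these terms vanish (Wick ordering)."* — PROVED for every LOCAL kernel: if Σ(x,x′) = 0 whenever x ≠ x′ (the kernel of a
tadpole graph, both external legs at its single vertex), then the graph expression plus its mass-renormalization counterterm,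
Σ_{x,x′} η^{2d} φ(x)·Σ(x,x′)φ′(x′) − Σ_x η^d φ(x)·(Σ_{x′} η^d Σ(x,x′))φ′(x), vanishes for all legs φ, φ′.
[cite: Balaban1983Higgs3, (3.7) p.435] -/
theorem subtracted319_eq_zero_of_local (η : ℝ) (Sg : Site P j → Site P j → W →ₗ[ℝ] W)
    (hloc : ∀ x x' : Site P j, x ≠ x' → Sg x x' = 0) (φ φ' : SiteField P j W) :
    subtracted319 η Sg φ φ' = 0 := by
  classical
  -- (3.19) with the discrete distance: the Hölder form has the factor φ′(x′) − φ′(x), which kills the diagonal,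
  -- and the kernel kills everything else
  rw [eq319 η 1 (fun x x' => if x = x' then 0 else 1) (fun x x' h => by simp [h]) Sg φ φ']
  unfold holderForm319
  refine Finset.sum_eq_zero fun x _ => Finset.sum_eq_zero fun x' _ => ?_
  by_cases h : x = x'
  · subst h
    simp
  · simp [hloc x x' h]

/-- the same cancellation stated as an equality of the two expressions: for a local kernel the graph term EQUALS the counterterm
Σ_x η^d φ(x)·(Σ_{x′} η^d Σ(x,x′))φ′(x) («the same graph with both external legs localized in x», p. 417).
[cite: Balaban1983Higgs3, (3.7) p.435] -/
theorem graphTerm_eq_counterTerm_of_local (η : ℝ) (Sg : Site P j → Site P j → W →ₗ[ℝ] W)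
    (hloc : ∀ x x' : Site P j, x ≠ x' → Sg x x' = 0) (φ φ' : SiteField P j W) :
    (∑ x : Site P j, ∑ x' : Site P j, η ^ (2 * P.d) * ⟪φ x, Sg x x' (φ' x')⟫) =
      ∑ x : Site P j, η ^ P.d * ⟪φ x, (∑ x' : Site P j, η ^ P.d • Sg x x') (φ' x)⟫ :=
  sub_eq_zero.mp (subtracted319_eq_zero_of_local η Sg hloc φ φ')

/-- the tadpole instance: the kernel η^{−d}·1_{x = x′}·T of a one-vertex graph (T a fixed map of the internal indices — for the
A′-tadpole (3.6)₂ a multiple of q², for the φ′-tadpole (3.6)₃ a multiple of the identity) plus its counterterm (3.7) vanishes.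
[cite: Balaban1983Higgs3, (3.7) p.435] -/
theorem tadpole_cancellation (η : ℝ) (T : W →ₗ[ℝ] W) (φ φ' : SiteField P j W) :
    subtracted319 η (fun x x' : Site P j => if x = x' then (η ^ P.d)⁻¹ • T else 0) φ φ' = 0 :=
  subtracted319_eq_zero_of_local η _ (fun x x' h => by simp [h]) φ φ'

/-- and the value of either term alone: the tadpole graph expression is the local quadratic form Σ_x η^d φ(x)·Tφ′(x) (for η ≠ 0).
[cite: Balaban1983Higgs3, (3.6) p.435] -/
theorem tadpole_graphTerm (η : ℝ) (hη : η ≠ 0) (T : W →ₗ[ℝ] W) (φ φ' : SiteField P j W) :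
    (∑ x : Site P j, ∑ x' : Site P j,
        η ^ (2 * P.d) * ⟪φ x, (if x = x' then (η ^ P.d)⁻¹ • T else (0 : W →ₗ[ℝ] W)) (φ' x')⟫) =
      ∑ x : Site P j, η ^ P.d * ⟪φ x, T (φ' x)⟫ := by
  classical
  refine Finset.sum_congr rfl fun x _ => ?_
  rw [Finset.sum_eq_single x (fun x' _ hx' => by simp [Ne.symm hx']) (fun hx => (hx (Finset.mem_univ x)).elim)]
  simp only [if_true, LinearMap.smul_apply, real_inner_smul_right]
  have hd : η ^ P.d ≠ 0 := pow_ne_zero _ hη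
  rw [two_mul, pow_add]
  field_simp

end Literature.MathematicalPhysics.QuantumFieldTheory.Balaban1983to89.B3Sect3WickCancellation
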